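import Literature.NumberTheory.EllipticCurves.NeronLocalHeightTateLemma
import Mathlib.Algebra.Order.Ring.IsNonarchimedean
import HarnessLib

/-!
# Tate's correction term vanishes at the good places (ATAEC Lemma VI.2.2 / Thm. VI.4.1 for Tate's `λ`)

Topic `NumberTheory/EllipticCurves` (family `abc`, G06; also `bsd`). For a Weierstrass equation `W`
over a field `K` and a **nonarchimedean** absolute value `v` at which the equation is integral
(`v(aᵢ) ≤ 1`), has good reduction (`v(Δ) = 1`) and residue characteristic `≠ 2` (`v(2) = 1`), this
file proves that Tate's correction term vanishes identically (`tateCorrection_eq_zero_of_good`),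
so that Tate's series `μ` is `0` and the Néron local height is the naive one,
`λᵥ(P) = ½ log⁺|x(P)|ᵥ` (`neronLocalHeight_eq_naiveLocalHeight_of_good`) — Silverman, *Advanced
Topics*, Lemma VI.2.2 ("for all `v ∉ S`, `λᵥ(P) = ½ max{v(x(P)⁻¹), 0}`", proved there as the more
precise Thm. VI.4.1), in Tate's normalisation and for the finitely many exceptions
`S ⊇ {v | v(2) ≠ 1 or v(Δ) ≠ 1 or some v(aᵢ) > 1}`. This is the ingredient of the local
decomposition ATAEC VI.2.1 that makes `Σ_v λᵥ(P)` a finite sum and `Σ_v λᵥ − ½ h_x` bounded.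

## Proof

The heart is `max_abv_duplication_eq`: `max{|φ₂(x)|ᵥ, |ψ₂²(x)|ᵥ} = max{|x|ᵥ⁴, 1}` for all `x ∈ K`.
The bound `≤` is the ultrametric inequality with `v(bᵢ) ≤ 1` (`abv_b₂_le_one`, …, from the
integrality of the `aᵢ`); for `|x|ᵥ > 1` the term `x⁴` dominates `φ₂(x)`
(`IsNonarchimedean.add_eq_left_of_lt`); for `|x|ᵥ ≤ 1` the Bézout identity
`Uφ₂ + Vψ₂² = 64Δ²` of `NeronLocalHeightTateLemma.lean` (`bezout_Φ_two_Ψ₂Sq`), whose `U, V` are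
`v`-integral, gives `1 = |64Δ²|ᵥ ≤ max{|φ₂(x)|ᵥ, |ψ₂²(x)|ᵥ}`. (Silverman proves VI.4.1 through the
reduction map instead; the residue characteristic `2` is excluded here because the identity is
used with `|64|ᵥ = 1`.)

## References

* J. H. Silverman, *Advanced Topics in the Arithmetic of Elliptic Curves*, GTM 151 (1994),
  Lemma VI.2.2 (p. 461), Thm. VI.4.1.
-/

noncomputable section

open scoped Classical

open Polynomial

namespace WeierstrassCurve.Affine.Point

section Nonarchimedean

variable {K : Type*} [Field K] {v : AbsoluteValue K ℝ} (hna : IsNonarchimedean v)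
include hna

/-! #### Closure properties of `{a | v a ≤ 1}` for a nonarchimedean absolute value -/

/-- `v(a + b) ≤ 1` if `v a, v b ≤ 1` (ultrametric inequality). [folklore] -/
theorem abv_add_le_one {a b : K} (ha : v a ≤ 1) (hb : v b ≤ 1) : v (a + b) ≤ 1 :=
  (hna a b).trans (max_le ha hb)

/-- `v(a − b) ≤ 1` if `v a, v b ≤ 1`. [folklore] -/
theorem abv_sub_le_one {a b : K} (ha : v a ≤ 1) (hb : v b ≤ 1) : v (a - b) ≤ 1 := by
  rw [sub_eq_add_neg]
  exact abv_add_le_one hna ha (by rwa [v.map_neg])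

omit hna in
/-- `v(a b) ≤ 1` if `v a, v b ≤ 1`. [folklore] -/
theorem abv_mul_le_one {a b : K} (ha : v a ≤ 1) (hb : v b ≤ 1) : v (a * b) ≤ 1 := by
  rw [v.map_mul]
  exact mul_le_one₀ ha (v.nonneg b) hb

omit hna in
/-- `v(aⁿ) ≤ 1` if `v a ≤ 1`. [folklore] -/
theorem abv_pow_le_one {a : K} (ha : v a ≤ 1) (n : ℕ) : v (a ^ n) ≤ 1 := by
  rw [v.map_pow]
  exact pow_le_one₀ (v.nonneg a) ha

omit hna in
/-- `v(−a) ≤ 1` if `v a ≤ 1`. [folklore] -/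
theorem abv_neg_le_one {a : K} (ha : v a ≤ 1) : v (-a) ≤ 1 := by rwa [v.map_neg]

/-- `v(n) ≤ 1` for numerals (nonarchimedean). [folklore] -/
theorem abv_ofNat_le_one (n : ℕ) [n.AtLeastTwo] : v (OfNat.ofNat n : K) ≤ 1 := by
  have := IsNonarchimedean.apply_natCast_le_one hna (f := v) (n := n)
  rw [← Nat.cast_ofNat]
  exact this

/-! #### Integrality of the `b`-invariants -/

variable {W : WeierstrassCurve K} (h₁ : v W.a₁ ≤ 1) (h₂ : v W.a₂ ≤ 1) (h₃ : v W.a₃ ≤ 1)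
  (h₄ : v W.a₄ ≤ 1) (h₆ : v W.a₆ ≤ 1)
include h₁ h₂ h₃ h₄ h₆

omit h₃ h₄ h₆ in
/-- `v(b₂) ≤ 1` for a `v`-integral equation. [folklore] -/
theorem abv_b₂_le_one : v W.b₂ ≤ 1 := by
  have h4 := abv_ofNat_le_one hna (K := K) 4
  unfold WeierstrassCurve.b₂
  apply_rules [abv_add_le_one, abv_mul_le_one, abv_pow_le_one]

omit h₂ h₆ in
/-- `v(b₄) ≤ 1` for a `v`-integral equation. [folklore] -/
theorem abv_b₄_le_one : v W.b₄ ≤ 1 := by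
  have h2 := abv_ofNat_le_one hna (K := K) 2
  unfold WeierstrassCurve.b₄
  apply_rules [abv_add_le_one, abv_mul_le_one, abv_pow_le_one]

omit h₁ h₂ h₄ in
/-- `v(b₆) ≤ 1` for a `v`-integral equation. [folklore] -/
theorem abv_b₆_le_one : v W.b₆ ≤ 1 := by
  have h4 := abv_ofNat_le_one hna (K := K) 4
  unfold WeierstrassCurve.b₆
  apply_rules [abv_add_le_one, abv_mul_le_one, abv_pow_le_one]

/-- `v(b₈) ≤ 1` for a `v`-integral equation. [folklore] -/
theorem abv_b₈_le_one : v W.b₈ ≤ 1 := by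
  have h4 := abv_ofNat_le_one hna (K := K) 4
  unfold WeierstrassCurve.b₈
  apply_rules [abv_add_le_one, abv_sub_le_one, abv_mul_le_one, abv_pow_le_one]

/-! #### The duplication quotient is identically `1` at a good place of residue characteristic `≠ 2` -/

/-- Upper bound at a `v`-integral place: `max{|φ₂(x)|, |ψ₂²(x)|} ≤ max{|x|,1}⁴` (ultrametric).
[folklore] -/
theorem max_abv_duplication_le (x : K) :
    max (v ((W.Φ 2).eval x)) (v (W.Ψ₂Sq.eval x)) ≤ max (v x) 1 ^ 4 := by
  have hb₂ := abv_b₂_le_one hna h₁ h₂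
  have hb₄ := abv_b₄_le_one hna h₁ h₃ h₄
  have hb₆ := abv_b₆_le_one hna h₃ h₆
  have hb₈ := abv_b₈_le_one hna h₁ h₂ h₃ h₄ h₆
  have htwo := abv_ofNat_le_one hna (K := K) 2
  have hfour := abv_ofNat_le_one hna (K := K) 4
  set m := max (v x) 1 with hm
  have hm1 : 1 ≤ m := le_max_right _ _
  -- a monomial `c xᵏ` with `v c ≤ 1`, `k ≤ 4` has `v ≤ m⁴`
  have hmon : ∀ (c : K) (k : ℕ), v c ≤ 1 → k ≤ 4 → v (c * x ^ k) ≤ m ^ 4 := fun c k hc hk =>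
    (abv_mul_pow_le v c x hk).trans (by nlinarith [one_le_pow₀ (n := 4) hm1])
  have hconst : ∀ (c : K), v c ≤ 1 → v c ≤ m ^ 4 := fun c hc => hc.trans (one_le_pow₀ hm1)
  refine max_le ?_ ?_
  · rw [eval_Φ_two]
    have e4 : v (x ^ 4) ≤ m ^ 4 := by simpa using hmon 1 4 (by simp) le_rfl
    have e2 : v (W.b₄ * x ^ 2) ≤ m ^ 4 := hmon _ 2 hb₄ (by norm_num)
    have e1 : v (2 * W.b₆ * x) ≤ m ^ 4 := by
      simpa using hmon (2 * W.b₆) 1 (abv_mul_le_one htwo hb₆) (by norm_num)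
    have e0 : v W.b₈ ≤ m ^ 4 := hconst _ hb₈
    have s1 : v (x ^ 4 - W.b₄ * x ^ 2) ≤ m ^ 4 := by
      rw [sub_eq_add_neg]; exact (hna _ _).trans (max_le e4 (by rwa [v.map_neg]))
    have s2 : v (x ^ 4 - W.b₄ * x ^ 2 - 2 * W.b₆ * x) ≤ m ^ 4 := by
      rw [sub_eq_add_neg]; exact (hna _ _).trans (max_le s1 (by rwa [v.map_neg]))
    rw [sub_eq_add_neg]; exact (hna _ _).trans (max_le s2 (by rwa [v.map_neg]))
  · rw [eval_Ψ₂Sq]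
    have e3 : v (4 * x ^ 3) ≤ m ^ 4 := hmon _ 3 hfour (by norm_num)
    have e2 : v (W.b₂ * x ^ 2) ≤ m ^ 4 := hmon _ 2 hb₂ (by norm_num)
    have e1 : v (2 * W.b₄ * x) ≤ m ^ 4 := by
      simpa using hmon (2 * W.b₄) 1 (abv_mul_le_one htwo hb₄) (by norm_num)
    have e0 : v W.b₆ ≤ m ^ 4 := hconst _ hb₆
    exact (hna _ _).trans (max_le ((hna _ _).trans (max_le ((hna _ _).trans (max_le e3 e2)) e1)) e0)

/-- **The duplication quotient is `1` at a good place** (the computation behind ATAEC Thm. VI.4.1 /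
Lemma VI.2.2 in Tate's normalisation): for a nonarchimedean `v` with `v(aᵢ) ≤ 1`, `v(Δ) = 1` and
`v(2) = 1`, `max{|φ₂(x)|ᵥ, |ψ₂²(x)|ᵥ} = max{|x|ᵥ⁴, 1}` for every `x ∈ K`. Proof: `≤` is the
ultrametric inequality; for `|x| > 1` the term `x⁴` dominates `φ₂(x)`; for `|x| ≤ 1` the Bézout
identity `Uφ₂ + Vψ₂² = 64Δ²` (`bezout_Φ_two_Ψ₂Sq`, with `v`-integral `U, V`) forces
`max{|φ₂(x)|, |ψ₂²(x)|} ≥ |64Δ²| = 1`. [folklore] -/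
theorem max_abv_duplication_eq (hΔ : v W.Δ = 1) (htwo : v 2 = 1) (x : K) :
    max (v ((W.Φ 2).eval x)) (v (W.Ψ₂Sq.eval x)) = max (v x ^ 4) 1 := by
  have hb₂ := abv_b₂_le_one hna h₁ h₂
  have hb₄ := abv_b₄_le_one hna h₁ h₃ h₄
  have hb₆ := abv_b₆_le_one hna h₃ h₆
  have hb₈ := abv_b₈_le_one hna h₁ h₂ h₃ h₄ h₆
  have hup := max_abv_duplication_le hna h₁ h₂ h₃ h₄ h₆ x
  have hm4 : max (v x ^ 4) 1 = max (v x) 1 ^ 4 := by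
    rcases le_total (v x) 1 with h | h
    · rw [max_eq_right h, one_pow, max_eq_right (pow_le_one₀ (v.nonneg x) h)]
    · rw [max_eq_left h, max_eq_left (one_le_pow₀ h)]
  rw [hm4]
  refine le_antisymm hup ?_
  by_cases hx : 1 < v x
  · -- `|φ₂(x)| = |x|⁴`
    have hx1 : 1 ≤ v x := hx.le
    rw [max_eq_left hx1]
    refine le_max_of_le_left (le_of_eq ?_)
    rw [eval_Φ_two]
    -- the tail has absolute value `< |x|⁴`
    have htail : v (-(W.b₄ * x ^ 2) + -(2 * W.b₆ * x) + -W.b₈) < v (x ^ 4) := by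
      have hx3 : v x ^ 3 < v x ^ 4 := by
        calc v x ^ 3 = v x ^ 3 * 1 := (mul_one _).symm
          _ < v x ^ 3 * v x := by gcongr
          _ = v x ^ 4 := by ring
      have t2 : v (-(W.b₄ * x ^ 2)) ≤ v x ^ 3 := by
        rw [v.map_neg, v.map_mul, v.map_pow]
        calc v W.b₄ * v x ^ 2 ≤ 1 * v x ^ 3 :=
              mul_le_mul hb₄ (pow_le_pow_right₀ hx1 (by norm_num)) (by positivity) zero_le_one
          _ = v x ^ 3 := one_mul _
      have t1 : v (-(2 * W.b₆ * x)) ≤ v x ^ 3 := by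
        rw [v.map_neg, v.map_mul]
        calc v (2 * W.b₆) * v x ≤ 1 * v x ^ 3 :=
              mul_le_mul (abv_mul_le_one htwo.le hb₆) (le_self_pow₀ hx1 three_ne_zero) (v.nonneg _)
                zero_le_one
          _ = v x ^ 3 := one_mul _
      have t0 : v (-W.b₈) ≤ v x ^ 3 := by
        rw [v.map_neg]
        exact hb₈.trans (one_le_pow₀ hx1)
      rw [v.map_pow]
      refine lt_of_le_of_lt ?_ hx3
      exact (hna _ _).trans (max_le ((hna _ _).trans (max_le t2 t1)) t0)
    have hrew : x ^ 4 - W.b₄ * x ^ 2 - 2 * W.b₆ * x - W.b₈ =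
        x ^ 4 + (-(W.b₄ * x ^ 2) + -(2 * W.b₆ * x) + -W.b₈) := by ring
    rw [hrew, IsNonarchimedean.add_eq_left_of_lt hna htail, v.map_pow]
  · -- `|x| ≤ 1`: Bézout
    push Not at hx
    rw [max_eq_right hx, one_pow]
    have hid := bezout_Φ_two_Ψ₂Sq W x
    simp only at hid
    set M := max (v ((W.Φ 2).eval x)) (v (W.Ψ₂Sq.eval x)) with hM
    -- integrality of the pieces
    have hA : v ((288 * W.b₄ - 12 * W.b₂ ^ 2) * x + (-2 * W.b₂ ^ 3 + 60 * W.b₂ * W.b₄ - 216 * W.b₆)) ≤ 1 := by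
      have := abv_ofNat_le_one hna (K := K) 288
      have := abv_ofNat_le_one hna (K := K) 12
      have := abv_ofNat_le_one hna (K := K) 60
      have := abv_ofNat_le_one hna (K := K) 216
      have h2' : v (2 : K) ≤ 1 := htwo.le
      apply_rules [abv_add_le_one, abv_sub_le_one, abv_mul_le_one, abv_pow_le_one, abv_neg_le_one]
    have hB : v ((4 * W.b₂ ^ 2 - 96 * W.b₄) * x ^ 2 + (W.b₂ ^ 3 - 28 * W.b₂ * W.b₄ + 72 * W.b₆) * x +
        (W.b₂ ^ 2 * W.b₄ - 32 * W.b₄ ^ 2 + 6 * W.b₂ * W.b₆)) ≤ 1 := by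
      have := abv_ofNat_le_one hna (K := K) 4
      have := abv_ofNat_le_one hna (K := K) 96
      have := abv_ofNat_le_one hna (K := K) 28
      have := abv_ofNat_le_one hna (K := K) 72
      have := abv_ofNat_le_one hna (K := K) 32
      have := abv_ofNat_le_one hna (K := K) 6
      apply_rules [abv_add_le_one, abv_sub_le_one, abv_mul_le_one, abv_pow_le_one, abv_neg_le_one]
    have hf : v (W.Ψ₂Sq.eval x) ≤ 1 := by
      rw [eval_Ψ₂Sq]
      have := abv_ofNat_le_one hna (K := K) 4
      have h2' : v (2 : K) ≤ 1 := htwo.le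
      apply_rules [abv_add_le_one, abv_mul_le_one, abv_pow_le_one]
    have h32 : v (32 * x + 4 * W.b₂) ≤ 1 := by
      have := abv_ofNat_le_one hna (K := K) 32
      have := abv_ofNat_le_one hna (K := K) 4
      apply_rules [abv_add_le_one, abv_mul_le_one]
    have h16 := abv_ofNat_le_one hna (K := K) 16
    set A := (288 * W.b₄ - 12 * W.b₂ ^ 2) * x + (-2 * W.b₂ ^ 3 + 60 * W.b₂ * W.b₄ - 216 * W.b₆)
    set B := (4 * W.b₂ ^ 2 - 96 * W.b₄) * x ^ 2 + (W.b₂ ^ 3 - 28 * W.b₂ * W.b₄ + 72 * W.b₆) * x +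
        (W.b₂ ^ 2 * W.b₄ - 32 * W.b₄ ^ 2 + 6 * W.b₂ * W.b₆)
    have hU : v (16 * B ^ 2) ≤ 1 := by apply_rules [abv_mul_le_one, abv_pow_le_one]
    have hV : v (B ^ 2 * (32 * x + 4 * W.b₂) + 16 * W.Δ * A - A ^ 2 * W.Ψ₂Sq.eval x) ≤ 1 := by
      have hΔ' : v W.Δ ≤ 1 := hΔ.le
      apply_rules [abv_add_le_one, abv_sub_le_one, abv_mul_le_one, abv_pow_le_one]
    -- `1 = |64 Δ²| ≤ max (|U||φ|) (|V||f|) ≤ M`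
    have h64 : v (64 * W.Δ ^ 2) = 1 := by
      rw [v.map_mul, v.map_pow, hΔ, one_pow, mul_one, show (64 : K) = 2 ^ 6 by norm_num, v.map_pow,
        htwo, one_pow]
    have hM0 : 0 ≤ M := le_max_of_le_left (v.nonneg _)
    calc (1 : ℝ) = v (64 * W.Δ ^ 2) := h64.symm
      _ = v (16 * B ^ 2 * (W.Φ 2).eval x +
            (B ^ 2 * (32 * x + 4 * W.b₂) + 16 * W.Δ * A - A ^ 2 * W.Ψ₂Sq.eval x) *
              W.Ψ₂Sq.eval x) := by rw [hid]
      _ ≤ max (v (16 * B ^ 2 * (W.Φ 2).eval x))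
            (v ((B ^ 2 * (32 * x + 4 * W.b₂) + 16 * W.Δ * A - A ^ 2 * W.Ψ₂Sq.eval x) *
              W.Ψ₂Sq.eval x)) := hna _ _
      _ ≤ max M M := by
          refine max_le_max ?_ ?_
          · calc v (16 * B ^ 2 * (W.Φ 2).eval x) = v (16 * B ^ 2) * v ((W.Φ 2).eval x) :=
                  v.map_mul _ _
              _ ≤ 1 * v ((W.Φ 2).eval x) := by gcongr
              _ ≤ M := by rw [one_mul]; exact le_max_left _ _
          · calc v ((B ^ 2 * (32 * x + 4 * W.b₂) + 16 * W.Δ * A - A ^ 2 * W.Ψ₂Sq.eval x) *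
                  W.Ψ₂Sq.eval x) =
                  v (B ^ 2 * (32 * x + 4 * W.b₂) + 16 * W.Δ * A - A ^ 2 * W.Ψ₂Sq.eval x) *
                    v (W.Ψ₂Sq.eval x) := v.map_mul _ _
              _ ≤ 1 * v (W.Ψ₂Sq.eval x) := by gcongr
              _ ≤ M := by rw [one_mul]; exact le_max_right _ _
      _ = M := max_self M

/-- **Tate's correction term vanishes at a good place of residue characteristic `≠ 2`**: for a
nonarchimedean absolute value `v` with `v(aᵢ) ≤ 1` (a `v`-integral equation), `v(Δ) = 1` (good
reduction) and `v(2) = 1`, `f(P) = 0` for every `P ∈ E(K)`; hence Tate's series `μ` vanishes and the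
Néron local height is the naive one, `λᵥ = λ₁,ᵥ = ½ log⁺|x|ᵥ` (ATAEC Thm. VI.4.1 for `P ∈ E₀ = E`,
Lemma VI.2.2). [cite: Silverman1994, Lemma VI.2.2] -/
theorem tateCorrection_eq_zero_of_good (hΔ : v W.Δ = 1) (htwo : v 2 = 1) (P : W.toAffine.Point) :
    tateCorrection v P = 0 := by
  cases P with
  | zero => rw [← WeierstrassCurve.Affine.Point.zero_def, tateCorrection_zero, hΔ, Real.log_one]; simp
  | some x y h =>
    rw [tateCorrection_some, max_abv_duplication_eq hna h₁ h₂ h₃ h₄ h₆ hΔ htwo x, div_self, Real.log_one,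
      hΔ, Real.log_one]
    · simp
    · exact (lt_max_of_lt_right one_pos).ne'

/-- At a good place (as in `tateCorrection_eq_zero_of_good`) Tate's series vanishes: `μ(P) = 0`.
[folklore] -/
theorem tateMu_eq_zero_of_good (hΔ : v W.Δ = 1) (htwo : v 2 = 1) (P : W.toAffine.Point) :
    tateMu v P = 0 := by
  unfold tateMu
  simp [tateCorrection_eq_zero_of_good hna h₁ h₂ h₃ h₄ h₆ hΔ htwo]

/-- At a good place (as in `tateCorrection_eq_zero_of_good`) the Néron local height is the naive
local height: `λᵥ(P) = ½ log⁺ |x(P)|ᵥ` (ATAEC Lemma VI.2.2 / Thm. VI.4.1 in Tate's normalisation,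
for residue characteristic `≠ 2`). [cite: Silverman1994, Lemma VI.2.2] -/
theorem neronLocalHeight_eq_naiveLocalHeight_of_good (hΔ : v W.Δ = 1) (htwo : v 2 = 1)
    (P : W.toAffine.Point) : neronLocalHeight v P = naiveLocalHeight v P := by
  rw [neronLocalHeight, tateMu_eq_zero_of_good hna h₁ h₂ h₃ h₄ h₆ hΔ htwo, add_zero]

end Nonarchimedean

end WeierstrassCurve.Affine.Point

end
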